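import Literature.NumberTheory.Transcendental.PhilipponZeroEstimateIdeals
import Literature.NumberTheory.Transcendental.PhilipponZeroEstimateLoc
import Literature.NumberTheory.Transcendental.PhilipponZeroEstimateP1nDescent
import Literature.RingTheory.KrullDimension.AffineCatenary
import Mathlib.RingTheory.Finiteness.Ideal
import HarnessLib

/-!
# Philippon's zero estimate on `𝔾ₐ × 𝔾ₘ^n`: preliminaries for the assembly

Topic `Literature/NumberTheory/Transcendental`. Thirteenth module of the inline discharge of
`Literature.NumberTheory.Transcendental.Philippon1986_GaGm`: small bridges used by the final
assembly of D. Roy's proof of Thm. 4.1 (Nesterenko–Philippon (eds.), LNM 1752, Ch. 11,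
pp. 218–220) in the affine model `G(ℂ) = ℂ × (ℂˣ)ⁿ` of `GaGmZariski.lean`. PROVED:

* `pow_subset_sumset` — the pointwise power `Σ^k` lies in Philippon's `Σ(k)` (`GaGm.sumset`);
* `exists_pow_le_loc_of_mem_minimalPrimes` — for a minimal prime `𝔭` of `I`, `𝔭^M ≤ loc 𝔭 I`
  (prime avoidance among the finitely many minimal primes and `⋂ Min(I) = √I`);
* `le_height_of_dimG_le` — for a prime `𝔭' ∌ u`, `dim_G Z(𝔭') ≤ d ⇒ n + 1 - d ≤ height 𝔭'`
  (Nullstellensatz in `G` and the dimension formula of affine domains,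
  `Literature.RingTheory.KrullDimension.ringKrullDim_quotient_add_height`);
* `exists_finset_span_eq_of_subset_Box` — a subset of a box piece has a finite subset with the
  same `ℂ`-span;
* `pow_succ_le_factorial_mul_choose` — `(t+1)^m ≤ m!·binom(t+m, m)`.

Order bookkeeping (`GaGm.VanishesToOrder.mono`, `GaGm.vanishesToOrder_one_iff`) lives in
`PhilipponZeroEstimate.lean`.

## References

* Yu. V. Nesterenko, P. Philippon (eds.), *Introduction to Algebraic Independence Theory*,
  LNM 1752, Springer 2001, Ch. 11 (D. Roy), §2.2, §4.
* P. Philippon, *Lemmes de zéros dans les groupes algébriques commutatifs*, Bull. Soc. Math.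
  France 114 (1986), 355–383, §2, §5.
-/

noncomputable section

open MvPolynomial Module
open scoped Pointwise

namespace Literature.NumberTheory.Transcendental

namespace GaGm

variable {n : ℕ}

/-! ### Sumsets and pointwise powers -/

/-- `Σ^k ⊆ Σ(k)`: a product of `k` elements of `Σ` lies in Philippon's `Σ(k)`. [folklore] -/
theorem pow_subset_sumset (S : Set (GaGm n)) : ∀ k : ℕ, S ^ k ⊆ sumset S k := by
  intro k
  induction k with
  | zero =>
    rw [pow_zero, sumset_zero]
    rfl
  | succ k ih =>
    rw [pow_succ]
    rintro _ ⟨y, hy, s, hs, rfl⟩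
    obtain ⟨f, hf, rfl⟩ := ih hy
    refine ⟨Fin.snoc f s, fun i => ?_, ?_⟩
    · refine Fin.lastCases ?_ (fun i' => ?_) i
      · simpa using hs
      · simpa using hf i'
    · rw [Fin.prod_univ_castSucc]
      simp

/-- `Σ(k) ⊆ Σ(k')` for `k ≤ k'` when `e ∈ Σ`. [folklore] -/
theorem sumset_mono {S : Set (GaGm n)} (h1 : (1 : GaGm n) ∈ S) {k k' : ℕ} (h : k ≤ k') :
    sumset S k ⊆ sumset S k' := by
  induction h with
  | refl => exact Set.Subset.rfl
  | step _ ih => exact ih.trans (Descent.sumset_subset_succ h1 _)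

/-! ### Minimal primes and components -/

/-- **For a minimal prime `𝔭` of `I`, some power `𝔭^M` lies in the component `loc 𝔭 I`.**
(Take `R ∈ ⋂_{𝔭' ≠ 𝔭 minimal} 𝔭' \ 𝔭`; for `f ∈ 𝔭`, `R f ∈ ⋂ Min(I) = √I`, so `(Rf)^e ∈ I` and
`f^e ∈ loc 𝔭 I`; then `𝔭 ≤ √(loc 𝔭 I)` and `𝔭` is finitely generated.) [folklore] -/
theorem exists_pow_le_loc_of_mem_minimalPrimes {I 𝔭 : Ideal (MvPolynomial (Fin (n + 1)) ℂ)}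
    (h𝔭 : 𝔭 ∈ I.minimalPrimes) : ∃ M : ℕ, 𝔭 ^ M ≤ loc 𝔭 h𝔭.1.1 I := by
  classical
  have h𝔭p : 𝔭.IsPrime := h𝔭.1.1
  set Min := (Ideal.finite_minimalPrimes_of_isNoetherianRing _ I).toFinset with hMin
  have hMinmem : ∀ 𝔭', 𝔭' ∈ Min ↔ 𝔭' ∈ I.minimalPrimes := fun 𝔭' => by rw [hMin, Set.Finite.mem_toFinset]
  -- elements `b 𝔭' ∈ 𝔭' \ 𝔭` for the other minimal primes
  have hb : ∀ 𝔭' ∈ Min.erase 𝔭, ∃ b : MvPolynomial (Fin (n + 1)) ℂ, b ∈ 𝔭' ∧ b ∉ 𝔭 := by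
    intro 𝔭' h𝔭'
    obtain ⟨hne, h𝔭'Min⟩ := Finset.mem_erase.mp h𝔭'
    rw [hMinmem] at h𝔭'Min
    have hnot : ¬ 𝔭' ≤ 𝔭 := fun hle => hne (le_antisymm hle (h𝔭.2 h𝔭'Min.1 hle))
    obtain ⟨b, hb𝔭', hb𝔭⟩ := Set.not_subset.mp hnot
    exact ⟨b, hb𝔭', hb𝔭⟩
  choose! b hb using hb
  set R := ∏ 𝔭' ∈ Min.erase 𝔭, b 𝔭' with hR
  have hR𝔭 : R ∉ 𝔭 := prod_notMem_of_isPrime h𝔭p _ b fun 𝔭' h𝔭' => (hb 𝔭' h𝔭').2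
  have hrad : 𝔭 ≤ (loc 𝔭 h𝔭p I).radical := by
    intro f hf
    -- `R f ∈ ⋂ Min(I) = √I`
    have h1 : R * f ∈ I.radical := by
      rw [← Ideal.sInf_minimalPrimes]
      refine Submodule.mem_sInf.mpr fun 𝔭' h𝔭' => ?_
      by_cases heq : 𝔭' = 𝔭
      · rw [heq]; exact 𝔭.mul_mem_left R hf
      · have hmem : 𝔭' ∈ Min.erase 𝔭 := Finset.mem_erase.mpr ⟨heq, (hMinmem 𝔭').mpr h𝔭'⟩
        refine Ideal.mul_mem_right _ _ ?_
        rw [hR, ← Finset.mul_prod_erase _ _ hmem]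
        exact Ideal.mul_mem_right _ _ (hb 𝔭' hmem).1
    obtain ⟨e, he⟩ := h1
    exact ⟨e, pow_mem_loc h𝔭p hR𝔭 he⟩
  exact Ideal.exists_pow_le_of_le_radical_of_fg hrad (IsNoetherian.noetherian 𝔭)

/-! ### Heights of primes with small zero set -/

/-- **Dimension bound to height bound**: for a prime `𝔭' ∌ u` of `B = ℂ[X, Y₁, …, Y_n]` whose
zero set in `G` has dimension `≤ d`, `n + 1 - d ≤ height 𝔭'` (Nullstellensatz in `G`:
`𝔍(Z(𝔭')) = 𝔭'`; dimension formula `dim B/𝔭' + height 𝔭' = n + 1`). [folklore] -/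
theorem le_height_of_dimG_le {𝔭' : Ideal (MvPolynomial (Fin (n + 1)) ℂ)} (h𝔭' : 𝔭'.IsPrime)
    (hu : torusUnit n ∉ 𝔭') {d : ℕ} (hdim : dimG (zeroSet (n := n) (𝔭' : Set (MvPolynomial (Fin (n + 1)) ℂ))) ≤ d) :
    ((n + 1 - d : ℕ) : ℕ∞) ≤ 𝔭'.height := by
  haveI := h𝔭'
  have hv := vanishing_zeroSet_eq_of_isPrime h𝔭' hu
  have hne : (zeroSet (n := n) (𝔭' : Set (MvPolynomial (Fin (n + 1)) ℂ))).Nonempty := by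
    by_contra h
    rw [Set.not_nonempty_iff_eq_empty] at h
    rw [h, vanishing_empty] at hv
    exact h𝔭'.ne_top hv.symm
  have hdimG := dimG_eq hne
  rw [hv] at hdimG
  have hformula := Literature.RingTheory.KrullDimension.ringKrullDim_quotient_add_height ℂ 𝔭'
  rw [ringKrullDim_poly, ← hdimG] at hformula
  -- finite height
  have hfin : 𝔭'.height ≠ ⊤ := by
    have h1 := Ideal.height_le_ringKrullDim_of_ne_top h𝔭'.ne_top
    rw [ringKrullDim_poly] at h1
    intro htop
    rw [htop] at h1
    have h2 : (⊤ : ℕ∞) ≤ ((n + 1 : ℕ) : ℕ∞) := by exact_mod_cast h1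
    exact absurd h2 (not_le.mpr (ENat.coe_lt_top (n + 1)))
  obtain ⟨h, hh⟩ := ENat.ne_top_iff_exists.mp hfin
  rw [← hh] at hformula ⊢
  have e : ((dimG (zeroSet (n := n) (𝔭' : Set (MvPolynomial (Fin (n + 1)) ℂ))) : WithBot ℕ∞) + ((h : ℕ∞) : WithBot ℕ∞)) =
      ((dimG (zeroSet (n := n) (𝔭' : Set (MvPolynomial (Fin (n + 1)) ℂ))) + h : ℕ) : WithBot ℕ∞) := by
    push_cast; rfl
  rw [e] at hformula
  have h2 : dimG (zeroSet (n := n) (𝔭' : Set (MvPolynomial (Fin (n + 1)) ℂ))) + h = n + 1 := by exact_mod_cast hformula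
  exact_mod_cast (show n + 1 - d ≤ h by omega)

/-! ### Finite generating sets inside a box -/

/-- A subset of a box piece has a finite subset with the same `ℂ`-span. [folklore] -/
theorem exists_finset_span_eq_of_subset_Box {D₀ D₁ t : ℕ} {F : Set (MvPolynomial (Fin (n + 1)) ℂ)}
    (hF : F ⊆ (Box (n := n) D₀ D₁ t : Set (MvPolynomial (Fin (n + 1)) ℂ))) :
    ∃ Fs : Finset (MvPolynomial (Fin (n + 1)) ℂ), (↑Fs : Set (MvPolynomial (Fin (n + 1)) ℂ)) ⊆ F ∧
      Submodule.span ℂ F = Submodule.span ℂ (↑Fs : Set (MvPolynomial (Fin (n + 1)) ℂ)) := by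
  have hle : Submodule.span ℂ F ≤ Box (n := n) D₀ D₁ t := Submodule.span_le.mpr hF
  haveI : FiniteDimensional ℂ ↥(Submodule.span ℂ F) := Submodule.finiteDimensional_of_le hle
  have hfg : (Submodule.span ℂ F).FG := (Submodule.fg_iff_finiteDimensional _).mpr inferInstance
  exact (Submodule.fg_span_iff_fg_span_finset_subset F).mp hfg

/-! ### An elementary inequality -/

/-- `(t+1)^m ≤ m! · binom(t+m, m)`. [folklore] -/
theorem pow_succ_le_factorial_mul_choose (t m : ℕ) : (t + 1) ^ m ≤ m.factorial * (t + m).choose m := by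
  rw [← Nat.descFactorial_eq_factorial_mul_choose]
  have h := Nat.pow_sub_le_descFactorial (t + m) m
  rwa [show t + m + 1 - m = t + 1 by omega] at h

end GaGm

end Literature.NumberTheory.Transcendental
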